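import Mathlib
import HarnessLib
import Literature.AlgebraicGeometry.Ramification.InertiaNormalSylow
import Literature.AlgebraicGeometry.Resolution.WeightedCentreGermsHeightTwoProofs
import Summits.ResolutionOfSingularities.ResolutionOfSingularities.Theorems.WildQuotientsWildQuotientResolutionTameCentreSNC

/-!
# A tame inert locus has simple normal crossings with a stable SNC BOUNDARY (any number of components)
# (crux `WildQuotients.WildQuotientResolution`, stub `stub_phaseZeroHighDim`; any dimension)

Crux stmt-ResolutionOfSingularities-15640 (`WildQuotientResolution`), registered stub `stub_phaseZeroHighDim`.
✓`hasSNCWith_inertLocus_of_hasSNC_singleton` (p822334) handles ONE stable boundary divisor; a p-standardisation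
with `k ≥ 3` moves carries a boundary with several components through a point. This file proves the general case:

**Theorem** (`hasSNCWith_inertLocus_of_hasSNC`). `G` acts on the locally Noetherian `X` with residue
characteristic `p`; `K ≤ G` has order prime to `p` with closed inert locus `Z_K`; `E` is a simple normal crossings
boundary (`HasSNC E`) all of whose members have `G`-stable support. Then `HasSNCWith E (𝓘_{Z_K})`.

Local algebra (`exists_exchange`, MULTI-EXCHANGE): if `(f, z)` is part of a regular system of parameters and
`b₁, …, b_s ∈ (f)` have linearly independent differentials, the `bⱼ` can be swapped into `f` one at a time without
changing `(f)` or the regularity of `(f, z)` — at each step a unit coefficient is available OFF the positions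
already occupied, by the independence of the `b̄ⱼ`. With the character dichotomy (✓p822157) and the transversal
append lemma (✓p817967) this yields `exists_rsop_labels_of_stableLines`: for boundary equations `b` (part of a
regular system of parameters, each `(bⱼ)` stable under the tame `K` on the nose) a minimal basis of `𝔪` containing
every `bⱼ` and generating the fixed-locus ideal `⨆ 𝔞_k` by a subset.

[OURS · crux stmt-ResolutionOfSingularities-15640 · helper toward `stub_phaseZeroHighDim` (SNC input of k-move
slices; NOT a proof of the stub); folklore local algebra, counted 0; AI-level work, weaker than expert review.]
[folklore]
-/

-- single-problem summit: the doubled namespace component `ResolutionOfSingularities` is forced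
set_option linter.dupNamespace false

noncomputable section

open CategoryTheory AlgebraicGeometry TopologicalSpace IsLocalRing
open Literature.AlgebraicGeometry.Resolution Literature.AlgebraicGeometry.Ramification
open Scheme.IdealSheafData
open Summit.ResolutionOfSingularities.ResolutionOfSingularities.Theorems.WildQuotientResolution.PointBlowupStalkData
open Summit.ResolutionOfSingularities.ResolutionOfSingularities.Theorems.WildQuotientResolution.InertLocusStalk

namespace Summit.ResolutionOfSingularities.ResolutionOfSingularities.Theorems.WildQuotientResolution.StandardForm

universe u

/-! ## Multi-exchange -/

section Exchange

variable {R : Type u} [CommRing R] [IsLocalRing R]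

omit [IsLocalRing R] in
/-- The ideal of an appended family is the sum of the two ideals. [folklore] -/
theorem span_range_append {c t : ℕ} (f : Fin c → R) (z : Fin t → R) :
    Ideal.span (Set.range (Fin.append f z)) = Ideal.span (Set.range f) ⊔ Ideal.span (Set.range z) := by
  rw [← Ideal.span_union]
  congr 1
  ext a
  constructor
  · rintro ⟨i, rfl⟩
    induction i using Fin.addCases with
    | left j => exact Or.inl ⟨j, by simp⟩
    | right k => exact Or.inr ⟨k, by simp⟩
  · rintro (⟨j, rfl⟩ | ⟨k, rfl⟩)
    · exact ⟨Fin.castAdd t j, by simp⟩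
    · exact ⟨Fin.natAdd c k, by simp⟩

omit [IsLocalRing R] in
/-- **Single exchange**: if `t = ∑ aᵢ fᵢ` with `a i₀` a unit, replacing `f i₀` by `t` does not change the ideal.
[folklore] -/
theorem span_range_update_eq {c : ℕ} (f : Fin c → R) (a : Fin c → R) (i₀ : Fin c) (hu : IsUnit (a i₀)) :
    Ideal.span (Set.range (Function.update f i₀ (∑ i, a i * f i))) = Ideal.span (Set.range f) := by
  classical
  set t := ∑ i, a i * f i with ht
  obtain ⟨b, hb⟩ := hu.exists_left_inv
  have htJ : t ∈ Ideal.span (Set.range f) :=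
    Ideal.sum_mem _ fun i _ => Ideal.mul_mem_left _ _ (Ideal.subset_span ⟨i, rfl⟩)
  apply le_antisymm
  · rw [Ideal.span_le]
    rintro _ ⟨i, rfl⟩
    by_cases hi : i = i₀
    · subst hi; rw [Function.update_self]; exact htJ
    · rw [Function.update_of_ne hi]; exact Ideal.subset_span ⟨i, rfl⟩
  · rw [Ideal.span_le]
    rintro _ ⟨i, rfl⟩
    by_cases hi : i = i₀
    · subst hi
      have hsum : a i * f i + ∑ j ∈ Finset.univ.erase i, a j * f j = t :=
        Finset.add_sum_erase Finset.univ (fun j => a j * f j) (Finset.mem_univ i)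
      have e : f i = b * (t - ∑ j ∈ Finset.univ.erase i, a j * f j) := by
        rw [← hsum, add_sub_cancel_right, ← mul_assoc, hb, one_mul]
      rw [SetLike.mem_coe, e]
      refine Ideal.mul_mem_left _ _ (sub_mem ?_ (Ideal.sum_mem _ fun j hj => Ideal.mul_mem_left _ _ ?_))
      · exact Ideal.subset_span ⟨i, Function.update_self i t f⟩
      · exact Ideal.subset_span ⟨j, Function.update_of_ne (Finset.ne_of_mem_erase hj) t f⟩
    · exact Ideal.subset_span ⟨i, Function.update_of_ne hi t f⟩

/-- Regularity of `(f, z)` as part of a regular system of parameters only depends on the ideal `(f)`.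
[cite: Matsumura1987, Thm. 14.2] -/
theorem isRsopPart_append_of_span_eq [IsNoetherianRing R] {c t : ℕ} {f f' : Fin c → R} {z : Fin t → R}
    (h : IsRsopPart (Fin.append f z)) (hspan : Ideal.span (Set.range f') = Ideal.span (Set.range f))
    (hf' : ∀ i, f' i ∈ maximalIdeal R) : IsRsopPart (Fin.append f' z) := by
  have heq : Ideal.span (Set.range (Fin.append f' z)) = Ideal.span (Set.range (Fin.append f z)) := by
    rw [span_range_append, span_range_append, hspan]
  have hm : ∀ i, Fin.append f' z i ∈ maximalIdeal R := by
    intro i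
    induction i using Fin.addCases with
    | left j => simpa using hf' j
    | right k => simpa using h.mem_maximalIdeal (Fin.natAdd c k)
  haveI : IsRegularLocalRing (R ⧸ Ideal.span (Set.range (Fin.append f' z))) := by
    rw [heq]; exact h.isRegularLocalRing_quotient
  refine IsRsopPart.of_isRegularLocalRing_quotient hm (le_of_eq ?_)
  rw [heq]
  exact h.ringKrullDim_quotient_add

/-- **Multi-exchange.** Let `(f, z)` be part of a regular system of parameters of the local ring `R` and
`b₁, …, b_s ∈ (f)` elements of `𝔪` with linearly independent images in `𝔪/𝔪²`. Then there is `f'` with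
`(f') = (f)`, `(f', z)` part of a regular system of parameters, and every `bⱼ` among the `f'ᵢ`. [folklore] -/
theorem exists_exchange [IsNoetherianRing R] {c t : ℕ} (z : Fin t → R) :
    ∀ (s : ℕ) (b : Fin s → R) (f : Fin c → R) (hbm : ∀ j, b j ∈ maximalIdeal R),
      (∀ j, b j ∈ Ideal.span (Set.range f)) →
      LinearIndependent (ResidueField R) (fun j => (maximalIdeal R).toCotangent ⟨b j, hbm j⟩) →
      IsRsopPart (Fin.append f z) →
      ∃ f' : Fin c → R, Ideal.span (Set.range f') = Ideal.span (Set.range f) ∧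
        IsRsopPart (Fin.append f' z) ∧ ∀ j, ∃ i, f' i = b j := by
  classical
  intro s
  induction s with
  | zero => exact fun b f hbm _ _ hfz => ⟨f, rfl, hfz, fun j => j.elim0⟩
  | succ s ih =>
    intro b f hbm hbJ hbli hfz
    -- exchange the first `s` elements
    have hbli' : LinearIndependent (ResidueField R)
        (fun j : Fin s => (maximalIdeal R).toCotangent ⟨b (Fin.castSucc j), hbm _⟩) :=
      hbli.comp Fin.castSucc (Fin.castSucc_injective s)
    obtain ⟨f₁, hspan₁, hfz₁, hpos⟩ := ih (b ∘ Fin.castSucc) f (fun j => hbm _) (fun j => hbJ _) hbli' hfz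
    choose pos hpos using hpos
    have hpos' : ∀ j, f₁ (pos j) = b (Fin.castSucc j) := fun j => by simpa using hpos j
    have hf₁m : ∀ i, f₁ i ∈ maximalIdeal R := fun i => by
      simpa using hfz₁.mem_maximalIdeal (Fin.castAdd t i)
    -- injectivity of the positions
    have hbinj : Function.Injective b := fun j j' h => by
      have := hbli.injective
      exact this (by simp only [h] : (fun j => (maximalIdeal R).toCotangent ⟨b j, hbm j⟩) j =
        (fun j => (maximalIdeal R).toCotangent ⟨b j, hbm j⟩) j')
    have hposinj : Function.Injective pos := fun j j' h =>
      Fin.castSucc_injective s (hbinj (show b (Fin.castSucc j) = b (Fin.castSucc j') by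
        rw [← hpos' j, ← hpos' j', h]))
    -- write the last element on the generators `f₁`
    have hlast : b (Fin.last s) ∈ Ideal.span (Set.range f₁) := hspan₁ ▸ hbJ (Fin.last s)
    obtain ⟨a, ha⟩ := Ideal.mem_span_range_iff_exists_fun.mp hlast
    -- a unit coefficient off the occupied positions
    have hunit : ∃ i₀, i₀ ∉ Set.range pos ∧ IsUnit (a i₀) := by
      by_contra hne
      push Not at hne
      set I₀ : Finset (Fin c) := Finset.univ.image pos with hI₀
      -- the relation `b_last - ∑ a (pos j) b j ∈ 𝔪²`
      let cc : Fin (s + 1) → R := Fin.snoc (fun j => -a (pos j)) 1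
      have hrel : ∑ j, cc j * b j ∈ maximalIdeal R ^ 2 := by
        rw [Fin.sum_univ_castSucc]
        simp only [cc, Fin.snoc_castSucc, Fin.snoc_last, one_mul]
        have h1 : ∑ j : Fin s, -a (pos j) * b (Fin.castSucc j) = -∑ i ∈ I₀, a i * f₁ i := by
          rw [hI₀, Finset.sum_image (fun j _ j' _ h => hposinj h), ← Finset.sum_neg_distrib]
          refine Finset.sum_congr rfl fun j _ => ?_
          rw [← hpos' j, neg_mul]
        rw [h1, ← ha, ← Finset.sum_add_sum_compl I₀ (fun i => a i * f₁ i), neg_add_cancel_left]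
        rw [pow_two]
        refine Ideal.sum_mem _ fun i hi => Ideal.mul_mem_mul ((IsLocalRing.mem_maximalIdeal _).mpr ?_) (hf₁m i)
        refine hne i fun ⟨j, hj⟩ => ?_
        rw [Finset.mem_compl, hI₀, Finset.mem_image] at hi
        exact hi ⟨j, Finset.mem_univ j, hj⟩
      have hall := (linearIndependent_toCotangent_iff_forall_mem b hbm).mp hbli cc hrel (Fin.last s)
      simp only [cc, Fin.snoc_last] at hall
      exact IsLocalRing.notMem_maximalIdeal.mpr isUnit_one hall
    obtain ⟨i₀, hi₀, hai₀⟩ := hunit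
    -- swap `f₁ i₀` for `b_last`
    refine ⟨Function.update f₁ i₀ (b (Fin.last s)), ?_, ?_, ?_⟩
    · rw [← hspan₁, ← ha]
      exact span_range_update_eq f₁ a i₀ hai₀
    · refine isRsopPart_append_of_span_eq hfz₁ ?_ fun i => ?_
      · rw [← ha]; exact span_range_update_eq f₁ a i₀ hai₀
      · by_cases hi : i = i₀
        · subst hi; rw [Function.update_self]; exact hbm _
        · rw [Function.update_of_ne hi]; exact hf₁m i
    · intro j
      induction j using Fin.lastCases with
      | last => exact ⟨i₀, Function.update_self i₀ _ f₁⟩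
      | cast j =>
        refine ⟨pos j, ?_⟩
        have hne : pos j ≠ i₀ := fun h => hi₀ ⟨j, h⟩
        rw [Function.update_of_ne hne, hpos' j]

end Exchange

/-! ## Labelled minimal bases for several stable boundary divisors -/

section Stable

variable {R : Type u} [CommRing R] [IsRegularLocalRing R] {K : Type*} [Group K] [Finite K]
  (τ : K →* (R ≃+* R))

/-- **A tame fixed locus has simple normal crossings with several stable boundary divisors.** Let `K` (finite, of
invertible order) act on the regular local `R` fixing the closed point, and let `b : Fin m → R` be part of a
regular system of parameters (the local equations of the boundary divisors through the point) with each ideal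
`(bⱼ)` stable under `K` on the nose. Then there is a minimal basis `u` of `𝔪` containing every `bⱼ`
(`u (ι j) = b j`, `ι` injective) and generating the fixed-locus ideal `⨆_g 𝔞_{τ g}` by a subset. [folklore] -/
theorem exists_rsop_labels_of_stableLines (hI : IsUnit ((Nat.card K : ℕ) : R))
    (hm : (⨆ g, augIdeal (τ g)) ≤ maximalIdeal R) {m : ℕ} (b : Fin m → R) (hb : IsRsopPart b)
    (hstab : ∀ (g : K) (j : Fin m), τ g (b j) ∈ Ideal.span {b j}) :
    ∃ u : Fin (maximalIdeal R).spanFinrank → R, Ideal.span (Set.range u) = maximalIdeal R ∧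
      (∃ ι : Fin m → Fin (maximalIdeal R).spanFinrank, Function.Injective ι ∧ ∀ j, u (ι j) = b j) ∧
      ∃ S : Set (Fin (maximalIdeal R).spanFinrank), (⨆ g, augIdeal (τ g)) = Ideal.span (u '' S) := by
  classical
  set J : Ideal R := ⨆ g, augIdeal (τ g) with hJdef
  have hbm : ∀ j, b j ∈ maximalIdeal R := hb.mem_maximalIdeal
  -- split the boundary equations: inside the fixed-locus ideal (`N`) or fixed to first order (`T`)
  have hdich : ∀ j, (∀ g : K, τ g (b j) - b j ∈ maximalIdeal R ^ 2) ∨ b j ∈ J := fun j =>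
    sub_mem_sq_or_mem_iSup_augIdeal τ (hbm j) (fun g => hstab g j)
  let PN : Fin m → Prop := fun j => b j ∈ J
  let sN := {j : Fin m // PN j}
  let sT := {j : Fin m // ¬ PN j}
  haveI : Fintype sN := inferInstance
  haveI : Fintype sT := inferInstance
  let eN := Fintype.equivFin sN
  let eT := Fintype.equivFin sT
  let bN : Fin (Fintype.card sN) → R := fun i => b (eN.symm i).1
  let zT : Fin (Fintype.card sT) → R := fun i => b (eT.symm i).1
  have hzT : ∀ i, zT i ∈ maximalIdeal R := fun i => hbm _
  have hzTfix : ∀ (g : K) (i : Fin (Fintype.card sT)), τ g (zT i) - zT i ∈ maximalIdeal R ^ 2 := by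
    intro g i
    rcases hdich (eT.symm i).1 with h | h
    · exact h g
    · exact absurd h (eT.symm i).2
  -- `zT` is part of a regular system of parameters (a sub-family of `b`), hence independent
  have hzTrsop : IsRsopPart zT :=
    hb.comp (fun i => (eT.symm i).1) fun i i' h => eT.symm.injective (Subtype.ext h)
  have hzTli : LinearIndependent (ResidueField R)
      (fun i => (maximalIdeal R).toCotangent ⟨zT i, hzT i⟩) :=
    WeightedInvariant.linearIndependent_toCotangent_of_isRsopPart hzTrsop hzT
  -- transversal append: `(f, zT)` rsop part with `(f) = J`
  obtain ⟨c, f, hspan, hfz⟩ := TameFixedLocus.exists_isRsopPart_append τ hI hm zT hzT hzTli hzTfix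
  -- exchange the `N`-type equations into `f`
  have hbNm : ∀ i, bN i ∈ maximalIdeal R := fun i => hbm _
  have hbNrsop : IsRsopPart bN :=
    hb.comp (fun i => (eN.symm i).1) fun i i' h => eN.symm.injective (Subtype.ext h)
  have hbNli : LinearIndependent (ResidueField R)
      (fun i => (maximalIdeal R).toCotangent ⟨bN i, hbNm i⟩) :=
    WeightedInvariant.linearIndependent_toCotangent_of_isRsopPart hbNrsop hbNm
  obtain ⟨f', hspan', hfz', hposN⟩ := exists_exchange zT _ bN f hbNm
    (fun i => by rw [hspan]; exact (eN.symm i).2) hbNli hfz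
  choose posN hposN using hposN
  -- the full minimal basis extending `(f', zT)`
  obtain ⟨e, x, hd, hx, hxw⟩ := hfz'.exists_rsop
  let σ : Fin (maximalIdeal R).spanFinrank ≃ Fin (c + Fintype.card sT + e) := finCongr hd
  -- label of the boundary equation `b j`
  let lab : Fin m → Fin (c + Fintype.card sT + e) := fun j =>
    if h : PN j then Fin.castAdd e (Fin.castAdd (Fintype.card sT) (posN (eN ⟨j, h⟩)))
    else Fin.castAdd e (Fin.natAdd c (eT ⟨j, h⟩))
  have hlab : ∀ j, x (lab j) = b j := by
    intro j
    by_cases h : PN j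
    · simp only [lab, dif_pos h, hxw, Fin.append_left, hposN]
      simp [bN]
    · simp only [lab, dif_neg h, hxw, Fin.append_right]
      simp [zT]
  refine ⟨x ∘ σ, ?_, ⟨σ.symm ∘ lab, ?_, fun j => ?_⟩, (σ.symm ∘ Fin.castAdd e ∘ Fin.castAdd _) '' Set.univ, ?_⟩
  · rw [Set.range_comp, σ.surjective.range_eq, Set.image_univ, hx]
  · -- injective: `x` is injective on the rsop and `b` is injective
    intro j j' h
    have h1 : x (lab j) = x (lab j') := by
      have := congrArg (x ∘ σ) h
      simpa [Function.comp_apply, Equiv.apply_symm_apply] using this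
    rw [hlab, hlab] at h1
    exact hb.injective h1
  · simp only [Function.comp_apply, Equiv.apply_symm_apply, hlab]
  · have hJf' : J = Ideal.span (Set.range f') := by rw [hspan', hspan]
    rw [hJf', ← Set.image_comp, Set.image_univ]
    congr 1
    ext a
    simp only [Set.mem_range, Function.comp_apply, Equiv.apply_symm_apply, hxw, Fin.append_left]

end Stable

/-! ## Scheme level: any number of stable boundary divisors -/

section SNC

variable {X : Scheme.{0}} {G : Type} [Group G] [Finite G] (σ : G →* Aut X) (p : ℕ) [Fact p.Prime]
  (K : Subgroup G)

/-- **A tame inert locus has simple normal crossings with a stable simple normal crossings boundary** (crux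
stmt-ResolutionOfSingularities-15640, toward `stub_phaseZeroHighDim`; any dimension, any number of boundary
components). `G` acts on `X` with residue characteristic `p`; `K ≤ G` has order prime to `p` with closed inert
locus `Z_K`; `E` is a boundary with `HasSNC E` all of whose members have `G`-stable support. Then
`HasSNCWith E (𝓘_{Z_K})`. [folklore] -/
theorem hasSNCWith_inertLocus_of_hasSNC
    (hchar : ∀ x : X, CharP (ResidueField (X.presheaf.stalk x)) p) (hcop : (Nat.card K).Coprime p)
    (hZ : IsClosed {y : X | K ≤ inertiaSubgroup σ y}) (E : List X.IdealSheafData) (hE : HasSNC E)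
    (hEstab : ∀ D ∈ E, ∀ g : G, (σ g).hom.base ⁻¹' (D.support : Set X) = D.support) :
    HasSNCWith E (vanishingIdeal ⟨{y : X | K ≤ inertiaSubgroup σ y}, hZ⟩) := by
  classical
  set Z : Closeds X := ⟨{y : X | K ≤ inertiaSubgroup σ y}, hZ⟩ with hZdef
  intro x
  haveI := hchar x
  -- boundary members through `x`
  let T := {D' : X.IdealSheafData // D' ∈ E ∧ x ∈ D'.support}
  haveI hTfin : Finite T :=
    (((List.finite_toSet E).subset (fun D' (h : D' ∈ E ∧ x ∈ D'.support) => h.1)).to_subtype :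
      Finite {D' : X.IdealSheafData | D' ∈ E ∧ x ∈ D'.support})
  haveI : Fintype T := Fintype.ofFinite T
  let eT : T ≃ Fin (Fintype.card T) := Fintype.equivFin T
  obtain ⟨hregx, u, hu, ⟨ι, hιinj, hι⟩, -⟩ := hE x
  haveI := hregx
  by_cases hxZ : x ∈ (vanishingIdeal Z).support
  swap
  · exact ⟨hregx, u, hu, ⟨ι, hιinj, hι⟩, fun h => absurd h hxZ⟩
  have hKx : K ≤ inertiaSubgroup σ x := by
    have h : x ∈ (Z : Set X) := by
      rw [← Scheme.IdealSheafData.coe_support_vanishingIdeal (Z := Z)]; exact hxZ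
    exact h
  obtain ⟨a, τ, hkey, hτ⟩ := exists_stalkAction σ x (inertiaSubgroup σ x)
    (fun g hg => apply_eq_of_mem_inertiaSubgroup σ hg)
  have hKu : IsUnit ((Nat.card K : ℕ) : X.presheaf.stalk x) :=
    TameFixedLocus.isUnit_natCast_of_not_dvd p
      ((Nat.Prime.coprime_iff_not_dvd (Fact.out : p.Prime)).mp hcop.symm)
  have hJx : stalkIdeal (vanishingIdeal Z) x =
      ⨆ k : K, augIdeal ((τ.comp (Subgroup.inclusion hKx)) k) :=
    stalkIdeal_vanishingIdeal_inertLocus_of_isUnit σ x a τ hkey hτ hKx hKu hKx hZ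
  have hm : (⨆ k : K, augIdeal ((τ.comp (Subgroup.inclusion hKx)) k)) ≤
      maximalIdeal (X.presheaf.stalk x) :=
    (mem_inertLocus_iff_iSup_augIdeal_le σ x a τ hkey hτ hKx).mp hKx
  -- the boundary equations through `x`: a sub-family of the rsop `u`, each stable on the nose
  let b : Fin (Fintype.card T) → X.presheaf.stalk x := fun i => u (ι (eT.symm i))
  have hb : IsRsopPart b :=
    isRsopPart_comp_of_rsop rfl u hu (fun i => ι (eT.symm i)) fun i i' h =>
      eT.symm.injective (hιinj h)
  have hvs : ∀ D' : T, stalkIdeal (vanishingIdeal D'.1.support) x = Ideal.span {u (ι D')} := fun D' => by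
    rw [hE.vanishingIdeal_support D'.2.1, hι D']
  have hstab : ∀ (k : K) (i : Fin (Fintype.card T)), (τ.comp (Subgroup.inclusion hKx)) k (b i) ∈
      Ideal.span {b i} := by
    intro k i
    rw [MonoidHom.comp_apply]
    have h := apply_mem_stalkIdeal_vanishingIdeal σ x a τ hkey hτ (eT.symm i).1.support
      (fun g => hEstab _ (eT.symm i).2.1 (g : G)) (Subgroup.inclusion hKx k)
      ((hvs (eT.symm i)) ▸ Ideal.mem_span_singleton_self _)
    rwa [hvs (eT.symm i)] at h
  obtain ⟨u', hu', ⟨ι', hι'inj, hι'⟩, S, hS⟩ :=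
    exists_rsop_labels_of_stableLines (τ.comp (Subgroup.inclusion hKx)) hKu hm b hb hstab
  refine ⟨hregx, u', hu', ⟨ι' ∘ eT, hι'inj.comp eT.injective, fun D' => ?_⟩, fun _ => ⟨S, ?_⟩⟩
  · rw [hι D', Function.comp_apply, hι']
    change Ideal.span {u (ι D')} = Ideal.span {u (ι (eT.symm (eT D')))}
    rw [Equiv.symm_apply_apply]
  · rw [hJx, hS]

end SNC

end Summit.ResolutionOfSingularities.ResolutionOfSingularities.Theorems.WildQuotientResolution.StandardForm

end
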